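import Literature.Analysis.PDE.SobolevEnergyLeibniz
import Mathlib.Algebra.Order.Chebyshev
import HarnessLib

/-!
# Sharp Leibniz bounds for the Sobolev energies: the top-order constant `1 + ε`
# (topic `Analysis/PDE`)

Analytic layer of the programme to prove short-time existence for quasilinear strictly
parabolic systems on a closed manifold (hypothesis `hQL` of
`Literature.Geometry.Riemannian.ricciFlow_shortTime_existence_of_quasilinear`). In the
parametrix (Neumann-series) construction of solutions of a linear parabolic system the
top-order "freezing error" `(I - B) : D²w` is small only through the oscillation `η = ‖I - B‖_∞`
of the principal coefficients, and it is measured in the energy `E_k` of EVERY order `k`; for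
the smallness condition on `η` to be independent of `k`, the Leibniz bound
`E_k(a • g) ≤ c · ‖a‖²_∞ · E_k(g) + (lower order)` must hold with a constant `c` that does not
grow with `k`. The bound of `SobolevEnergyLeibniz.lean` has `c = 2^{k+1}`; here we prove the
sharp form with `c = 1 + ε` for every `ε ∈ (0, 1]`:

* `sobolevEnergy_smul_le_sharp` — for every `k` and `ε ∈ (0, 1]` there is `C < ∞` with
  `E_{k+1}(a • g) ≤ (1 + ε) M₀² E_{k+1}(g) + C M² E_k(g)` whenever `|a| ≤ M₀` and the iterated
  directional derivatives of `a` of orders `1, …, k + 1` are bounded by `M`;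
* the tools: the `ε`-Young form of the parallelogram bound
  `‖u + v‖² ≤ (1 + ε)‖u‖² + (1 + ε⁻¹)‖v‖²` (`norm_add_sq_le_eps`, `enorm_add_sq_le_eps`,
  `lintegral_enorm_add_sq_le_eps`), its consequence `sobolevEnergy_add_le_eps` at every order,
  the crude all-derivative bound `sobolevEnergy_smul_le_crude` (`E_k(a • g) ≤ C M² E_k(g)`),
  and the Cauchy–Schwarz bound for finite sums `sobolevEnergy_sum_le_card`
  (`E_k(Σ_{i ∈ s} fᵢ) ≤ #s · Σ_{i ∈ s} E_k(fᵢ)`, improving the factor `2^{#s}` of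
  `sobolevEnergy_sum_le`);
* the form used for principal parts: `sobolevEnergy_sum_smul_le_sharp`,
  `E_{k+1}(Σ_p m_p • g_p) ≤ #s Σ_p [(1 + ε) M₀² E_{k+1}(g_p) + C M² E_k(g_p)]`.

The induction behind the sharp bound: `E_{k+2}(ag) = ∫|ag|² + Σᵢ E_{k+1}(a ∂ᵢg + (∂ᵢa) g)`;
split the sum with weights `1 + δ`, `1 + δ⁻¹` (`δ = ε/3`), use the induction hypothesis with
`δ` on `a ∂ᵢg` and the crude bound on `(∂ᵢa) g`, and note `(1 + δ)² ≤ 1 + ε`.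

Everything is proved; no named fact and no `sorry` is introduced.

## References

* L. C. Evans, *Partial Differential Equations*, 2nd ed., AMS 2010, §5.2.3, Thm. 1 (Leibniz
  formula for weak derivatives) and §B.2 (Cauchy's inequality with `ε`). [Evans2010]
* R. A. Adams, *Sobolev Spaces*, Academic Press 1975, ¶3.1 (the sum-form `H^k` norm).
  [Adams1975]
-/

noncomputable section

open MeasureTheory Set Function Filter Topology
open scoped ENNReal ContDiff

namespace Literature.Analysis.PDE

open Literature.Analysis.FunctionSpaces

variable {E : Type*} [NormedAddCommGroup E] [InnerProductSpace ℝ E] [FiniteDimensional ℝ E]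
  [MeasurableSpace E] [BorelSpace E]
variable {F : Type*} [NormedAddCommGroup F] [NormedSpace ℝ F]

/-! ### Cauchy's inequality with `ε` for squares of norms -/

omit [NormedSpace ℝ F] in
/-- **Cauchy's inequality with `ε`** for the square of a sum of two vectors:
`‖a + b‖² ≤ (1 + ε)‖a‖² + (1 + ε⁻¹)‖b‖²` (`ε > 0`). [cite: Evans2010, §B.2] -/
theorem norm_add_sq_le_eps {ε : ℝ} (hε : 0 < ε) (a b : F) :
    ‖a + b‖ ^ 2 ≤ (1 + ε) * ‖a‖ ^ 2 + (1 + ε⁻¹) * ‖b‖ ^ 2 := by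
  have h1 : ‖a + b‖ ^ 2 ≤ (‖a‖ + ‖b‖) ^ 2 :=
    pow_le_pow_left₀ (norm_nonneg _) (norm_add_le a b) 2
  have key : 2 * ‖a‖ * ‖b‖ ≤ ε * ‖a‖ ^ 2 + ε⁻¹ * ‖b‖ ^ 2 := by
    have h := sq_nonneg (ε * ‖a‖ - ‖b‖)
    have h2 : ε * (2 * ‖a‖ * ‖b‖) ≤ ε * (ε * ‖a‖ ^ 2 + ε⁻¹ * ‖b‖ ^ 2) := by
      rw [mul_add, ← mul_assoc ε ε⁻¹, mul_inv_cancel₀ hε.ne', one_mul]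
      nlinarith [h]
    exact le_of_mul_le_mul_left h2 hε
  nlinarith [h1, key]

omit [NormedSpace ℝ F] in
/-- The `ℝ≥0∞` form: `‖a + b‖ₑ² ≤ (1 + ε)‖a‖ₑ² + (1 + ε⁻¹)‖b‖ₑ²`. [cite: Evans2010, §B.2] -/
theorem enorm_add_sq_le_eps {ε : ℝ} (hε : 0 < ε) (a b : F) :
    ‖a + b‖ₑ ^ 2 ≤ ENNReal.ofReal (1 + ε) * ‖a‖ₑ ^ 2 + ENNReal.ofReal (1 + ε⁻¹) * ‖b‖ₑ ^ 2 := by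
  have hε' : 0 ≤ ε⁻¹ := inv_nonneg.2 hε.le
  have h := norm_add_sq_le_eps hε a b
  have h1 : ‖a + b‖ₑ ^ 2 = ENNReal.ofReal (‖a + b‖ ^ 2) := by
    rw [← ofReal_norm, ENNReal.ofReal_pow (norm_nonneg _)]
  have h2 : ENNReal.ofReal ((1 + ε) * ‖a‖ ^ 2 + (1 + ε⁻¹) * ‖b‖ ^ 2) =
      ENNReal.ofReal (1 + ε) * ‖a‖ₑ ^ 2 + ENNReal.ofReal (1 + ε⁻¹) * ‖b‖ₑ ^ 2 := by
    rw [ENNReal.ofReal_add (p := (1 + ε) * ‖a‖ ^ 2) (by positivity) (by positivity),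
      ENNReal.ofReal_mul (p := 1 + ε) (by positivity),
      ENNReal.ofReal_mul (p := 1 + ε⁻¹) (by positivity), ENNReal.ofReal_pow (norm_nonneg a),
      ENNReal.ofReal_pow (norm_nonneg b), ofReal_norm, ofReal_norm]
  rw [h1, ← h2]
  exact ENNReal.ofReal_le_ofReal h

omit [NormedSpace ℝ F] in
/-- The order-`0` form: `∫‖f + g‖² ≤ (1 + ε)∫‖f‖² + (1 + ε⁻¹)∫‖g‖²` for continuous `f`.
[cite: Evans2010, §B.2] -/
theorem lintegral_enorm_add_sq_le_eps {f g : E → F} (hf : Continuous f) {ε : ℝ} (hε : 0 < ε) :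
    ∫⁻ x, ‖f x + g x‖ₑ ^ 2 ≤ ENNReal.ofReal (1 + ε) * (∫⁻ x, ‖f x‖ₑ ^ 2) +
      ENNReal.ofReal (1 + ε⁻¹) * (∫⁻ x, ‖g x‖ₑ ^ 2) := by
  have hm : Measurable fun x ↦ ENNReal.ofReal (1 + ε) * ‖f x‖ₑ ^ 2 :=
    measurable_const.mul ((continuous_enorm.comp hf).measurable.pow_const 2)
  calc ∫⁻ x, ‖f x + g x‖ₑ ^ 2
      ≤ ∫⁻ x, (ENNReal.ofReal (1 + ε) * ‖f x‖ₑ ^ 2 + ENNReal.ofReal (1 + ε⁻¹) * ‖g x‖ₑ ^ 2) :=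
        lintegral_mono fun x ↦ enorm_add_sq_le_eps hε _ _
    _ = ENNReal.ofReal (1 + ε) * (∫⁻ x, ‖f x‖ₑ ^ 2) +
        ENNReal.ofReal (1 + ε⁻¹) * (∫⁻ x, ‖g x‖ₑ ^ 2) := by
        rw [lintegral_add_left hm, lintegral_const_mul' _ _ (by simp),
          lintegral_const_mul' _ _ (by simp)]

/-- **Subadditivity with `ε` at every order**: `E_k(f + g) ≤ (1 + ε) E_k(f) + (1 + ε⁻¹) E_k(g)`
for `f, g` of class `C^k` and `ε > 0`. [cite: Evans2010, §B.2] -/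
theorem sobolevEnergy_add_le_eps (k : ℕ) : ∀ {f g : E → F}, ContDiff ℝ k f → ContDiff ℝ k g →
    ∀ {ε : ℝ}, 0 < ε →
    sobolevEnergy k (fun x ↦ f x + g x) ≤ ENNReal.ofReal (1 + ε) * sobolevEnergy k f +
      ENNReal.ofReal (1 + ε⁻¹) * sobolevEnergy k g := by
  induction k with
  | zero =>
    intro f g hf _ ε hε
    simp only [sobolevEnergy_zero_left]
    exact lintegral_enorm_add_sq_le_eps hf.continuous hε
  | succ k ih =>
    intro f g hf hg ε hε
    rw [sobolevEnergy_succ, sobolevEnergy_succ, sobolevEnergy_succ]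
    have hdf : Differentiable ℝ f := hf.differentiable (by simp)
    have hdg : Differentiable ℝ g := hg.differentiable (by simp)
    have h0 := lintegral_enorm_add_sq_le_eps (g := g) hf.continuous hε
    have h1 : ∀ i, sobolevEnergy k (fun x ↦ fderiv ℝ (fun y ↦ f y + g y) x
        (stdOrthonormalBasis ℝ E i)) ≤
        ENNReal.ofReal (1 + ε) * sobolevEnergy k (fun x ↦ fderiv ℝ f x (stdOrthonormalBasis ℝ E i)) +
          ENNReal.ofReal (1 + ε⁻¹) *
            sobolevEnergy k (fun x ↦ fderiv ℝ g x (stdOrthonormalBasis ℝ E i)) := fun i ↦ by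
      have heq : (fun x ↦ fderiv ℝ (fun y ↦ f y + g y) x (stdOrthonormalBasis ℝ E i)) =
          fun x ↦ fderiv ℝ f x (stdOrthonormalBasis ℝ E i) +
            fderiv ℝ g x (stdOrthonormalBasis ℝ E i) := by
        funext x
        rw [fderiv_fun_add (hdf x) (hdg x)]
        rfl
      rw [heq]
      exact ih ((hf.fderiv_right (m := k) (by norm_cast)).clm_apply contDiff_const)
        ((hg.fderiv_right (m := k) (by norm_cast)).clm_apply contDiff_const) hε
    set c₁ := ENNReal.ofReal (1 + ε)
    set c₂ := ENNReal.ofReal (1 + ε⁻¹)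
    set A := ∫⁻ x, ‖f x‖ₑ ^ 2
    set B := ∫⁻ x, ‖g x‖ₑ ^ 2
    set a := fun i ↦ sobolevEnergy k (fun x ↦ fderiv ℝ f x (stdOrthonormalBasis ℝ E i))
    set b := fun i ↦ sobolevEnergy k (fun x ↦ fderiv ℝ g x (stdOrthonormalBasis ℝ E i))
    calc (∫⁻ x, ‖f x + g x‖ₑ ^ 2) + ∑ i, sobolevEnergy k
          (fun x ↦ fderiv ℝ (fun y ↦ f y + g y) x (stdOrthonormalBasis ℝ E i))
        ≤ (c₁ * A + c₂ * B) + ∑ i, (c₁ * a i + c₂ * b i) :=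
          add_le_add h0 (Finset.sum_le_sum fun i _ ↦ h1 i)
      _ = c₁ * (A + ∑ i, a i) + c₂ * (B + ∑ i, b i) := by
          rw [Finset.sum_add_distrib, ← Finset.mul_sum, ← Finset.mul_sum]
          ring

/-! ### Finite sums: the Cauchy–Schwarz constant `#s` -/

omit [NormedSpace ℝ F] in
/-- Pointwise: `‖Σ_{i ∈ s} aᵢ‖ₑ² ≤ #s · Σ_{i ∈ s} ‖aᵢ‖ₑ²`. [folklore] -/
theorem enorm_sum_sq_le_card {ι : Type*} (s : Finset ι) (a : ι → F) :
    ‖∑ i ∈ s, a i‖ₑ ^ 2 ≤ (s.card : ℝ≥0∞) * ∑ i ∈ s, ‖a i‖ₑ ^ 2 := by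
  have h : ‖∑ i ∈ s, a i‖ ^ 2 ≤ s.card * ∑ i ∈ s, ‖a i‖ ^ 2 :=
    calc ‖∑ i ∈ s, a i‖ ^ 2 ≤ (∑ i ∈ s, ‖a i‖) ^ 2 :=
          pow_le_pow_left₀ (norm_nonneg _) (norm_sum_le s a) 2
      _ ≤ s.card * ∑ i ∈ s, ‖a i‖ ^ 2 := sq_sum_le_card_mul_sum_sq
  have h1 : ‖∑ i ∈ s, a i‖ₑ ^ 2 = ENNReal.ofReal (‖∑ i ∈ s, a i‖ ^ 2) := by
    rw [← ofReal_norm, ENNReal.ofReal_pow (norm_nonneg _)]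
  have h2 : (s.card : ℝ≥0∞) * ∑ i ∈ s, ‖a i‖ₑ ^ 2 =
      ENNReal.ofReal (s.card * ∑ i ∈ s, ‖a i‖ ^ 2) := by
    rw [ENNReal.ofReal_mul (by positivity), ENNReal.ofReal_natCast,
      ENNReal.ofReal_sum_of_nonneg (fun i _ ↦ by positivity)]
    congr 1
    refine Finset.sum_congr rfl fun i _ ↦ ?_
    rw [← ofReal_norm, ENNReal.ofReal_pow (norm_nonneg _)]
  rw [h1, h2]
  exact ENNReal.ofReal_le_ofReal h

omit [NormedSpace ℝ F] in
/-- Order `0`: `∫‖Σ_{i ∈ s} fᵢ‖² ≤ #s · Σ_{i ∈ s} ∫‖fᵢ‖²` for continuous `fᵢ`. [folklore] -/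
theorem lintegral_enorm_sum_sq_le_card {ι : Type*} (s : Finset ι) {f : ι → E → F}
    (hf : ∀ i ∈ s, Continuous (f i)) :
    ∫⁻ x, ‖∑ i ∈ s, f i x‖ₑ ^ 2 ≤ (s.card : ℝ≥0∞) * ∑ i ∈ s, ∫⁻ x, ‖f i x‖ₑ ^ 2 := by
  have hm : ∀ i ∈ s, AEMeasurable (fun x ↦ ‖f i x‖ₑ ^ 2) volume := fun i hi ↦
    ((continuous_enorm.comp (hf i hi)).measurable.pow_const 2).aemeasurable
  calc ∫⁻ x, ‖∑ i ∈ s, f i x‖ₑ ^ 2 ≤ ∫⁻ x, (s.card : ℝ≥0∞) * ∑ i ∈ s, ‖f i x‖ₑ ^ 2 :=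
        lintegral_mono fun x ↦ enorm_sum_sq_le_card s (fun i ↦ f i x)
    _ = (s.card : ℝ≥0∞) * ∑ i ∈ s, ∫⁻ x, ‖f i x‖ₑ ^ 2 := by
        rw [lintegral_const_mul' _ _ (by simp), lintegral_finsetSum' s hm]

/-- **Finite sums, Cauchy–Schwarz constant**: `E_k(Σ_{i ∈ s} fᵢ) ≤ #s · Σ_{i ∈ s} E_k(fᵢ)`
(class `C^k`). [cite: Adams1975, ¶3.1] -/
theorem sobolevEnergy_sum_le_card (k : ℕ) : ∀ {ι : Type*} (s : Finset ι) {f : ι → E → F},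
    (∀ i ∈ s, ContDiff ℝ k (f i)) →
    sobolevEnergy k (fun x ↦ ∑ i ∈ s, f i x) ≤ (s.card : ℝ≥0∞) * ∑ i ∈ s, sobolevEnergy k (f i) := by
  induction k with
  | zero =>
    intro ι s f hf
    simp only [sobolevEnergy_zero_left]
    exact lintegral_enorm_sum_sq_le_card s fun i hi ↦ (hf i hi).continuous
  | succ k ih =>
    intro ι s f hf
    rw [sobolevEnergy_succ]
    have hd : ∀ i ∈ s, Differentiable ℝ (f i) := fun i hi ↦ (hf i hi).differentiable (by simp)
    have h0 := lintegral_enorm_sum_sq_le_card s (fun i hi ↦ (hf i hi).continuous)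
    have h1 : ∀ j, sobolevEnergy k (fun x ↦ fderiv ℝ (fun y ↦ ∑ i ∈ s, f i y) x
        (stdOrthonormalBasis ℝ E j)) ≤ (s.card : ℝ≥0∞) *
          ∑ i ∈ s, sobolevEnergy k (fun x ↦ fderiv ℝ (f i) x (stdOrthonormalBasis ℝ E j)) := by
      intro j
      have heq : (fun x ↦ fderiv ℝ (fun y ↦ ∑ i ∈ s, f i y) x (stdOrthonormalBasis ℝ E j)) =
          fun x ↦ ∑ i ∈ s, fderiv ℝ (f i) x (stdOrthonormalBasis ℝ E j) := by
        funext x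
        rw [fderiv_fun_sum fun i hi ↦ hd i hi x]
        simp only [FunLike.coe_sum, Finset.sum_apply]
      rw [heq]
      exact ih s fun i hi ↦ ((hf i hi).fderiv_right (m := k) (by norm_cast)).clm_apply
        contDiff_const
    calc (∫⁻ x, ‖∑ i ∈ s, f i x‖ₑ ^ 2) + ∑ j, sobolevEnergy k
          (fun x ↦ fderiv ℝ (fun y ↦ ∑ i ∈ s, f i y) x (stdOrthonormalBasis ℝ E j))
        ≤ (s.card : ℝ≥0∞) * ∑ i ∈ s, (∫⁻ x, ‖f i x‖ₑ ^ 2) + ∑ j, (s.card : ℝ≥0∞) *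
            ∑ i ∈ s, sobolevEnergy k (fun x ↦ fderiv ℝ (f i) x (stdOrthonormalBasis ℝ E j)) :=
          add_le_add h0 (Finset.sum_le_sum fun j _ ↦ h1 j)
      _ = (s.card : ℝ≥0∞) * ∑ i ∈ s, sobolevEnergy (k + 1) (f i) := by
          rw [← Finset.mul_sum, ← mul_add, Finset.sum_comm, ← Finset.sum_add_distrib]
          rfl

/-! ### The crude all-derivative Leibniz bound -/

/-- **Crude Leibniz bound**: for every `k` there is `C < ∞` with `E_k(a • g) ≤ C M² E_k(g)`
whenever `|a| ≤ M` and all iterated directional derivatives of `a` along the standard frame of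
orders `1, …, k` are bounded by `M` (`a, g` smooth). [cite: Evans2010, §5.2.3, Thm. 1] -/
theorem sobolevEnergy_smul_le_crude (k : ℕ) :
    ∃ C : ℝ≥0∞, C ≠ ⊤ ∧ ∀ {a : E → ℝ} {g : E → F}, ContDiff ℝ ∞ a → ContDiff ℝ ∞ g →
      ∀ {M : ℝ}, (∀ x, |a x| ≤ M) →
        (∀ l : List (Fin (Module.finrank ℝ E)), l ≠ [] → l.length ≤ k →
          ∀ x, ‖iterDirDeriv (l.map (stdOrthonormalBasis ℝ E)) a x‖ ≤ M) →
        sobolevEnergy k (fun x ↦ a x • g x) ≤ C * ENNReal.ofReal (M ^ 2) * sobolevEnergy k g := by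
  cases k with
  | zero =>
    refine ⟨1, ENNReal.one_ne_top, ?_⟩
    intro a g _ _ M h0 _
    rw [one_mul]
    exact sobolevEnergy_smul_le_zero h0 g
  | succ k =>
    obtain ⟨C, hCtop, hC⟩ := sobolevEnergy_smul_le_succ (E := E) (F := F) k
    refine ⟨2 ^ (k + 1) + C, ENNReal.add_ne_top.2 ⟨by simp, hCtop⟩, ?_⟩
    intro a g ha hg M h0 h1
    refine (hC ha hg h0 h1).trans ?_
    rw [add_mul, add_mul]
    exact add_le_add le_rfl (mul_le_mul' le_rfl (sobolevEnergy_le_succ k g))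

/-! ### The sharp Leibniz bound -/

/-- Arithmetic: `(1 + ε/3)² ≤ 1 + ε` for `0 ≤ ε ≤ 1`. [folklore] -/
theorem one_add_third_sq_le {ε : ℝ} (hε : 0 ≤ ε) (hε1 : ε ≤ 1) :
    (1 + ε / 3) ^ 2 ≤ 1 + ε := by
  nlinarith

/-- **The sharp Leibniz bound at every order.** For every `k` and every `ε ∈ (0, 1]` there is
`C < ∞` (depending only on `k`, `ε` and `dim E`) such that for smooth `a : E → ℝ`, `g : E → F`
with `|a| ≤ M₀` and all iterated directional derivatives of `a` along the standard frame of
orders `1, …, k + 1` bounded by `M`: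
`E_{k+1}(a • g) ≤ (1 + ε) M₀² E_{k+1}(g) + C M² E_k(g)`.
The top-order constant `1 + ε` does not depend on `k`. [cite: Evans2010, §5.2.3, Thm. 1] -/
theorem sobolevEnergy_smul_le_sharp (k : ℕ) : ∀ {ε : ℝ}, 0 < ε → ε ≤ 1 →
    ∃ C : ℝ≥0∞, C ≠ ⊤ ∧ ∀ {a : E → ℝ} {g : E → F}, ContDiff ℝ ∞ a → ContDiff ℝ ∞ g →
      ∀ {M₀ M : ℝ}, (∀ x, |a x| ≤ M₀) →
        (∀ l : List (Fin (Module.finrank ℝ E)), l ≠ [] → l.length ≤ k + 1 →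
          ∀ x, ‖iterDirDeriv (l.map (stdOrthonormalBasis ℝ E)) a x‖ ≤ M) →
        sobolevEnergy (k + 1) (fun x ↦ a x • g x) ≤
          ENNReal.ofReal (1 + ε) * ENNReal.ofReal (M₀ ^ 2) * sobolevEnergy (k + 1) g +
            C * ENNReal.ofReal (M ^ 2) * sobolevEnergy k g := by
  induction k with
  | zero =>
    intro ε hε _
    -- `E_1(ag) ≤ M₀²E_0 g + Σᵢ ((1+ε)M₀² E_0(∂ᵢg) + (1+ε⁻¹)M² E_0 g)`
    refine ⟨(Module.finrank ℝ E : ℝ≥0∞) * ENNReal.ofReal (1 + ε⁻¹),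
      ENNReal.mul_ne_top (by simp) (by simp), ?_⟩
    intro a g ha hg M₀ M h0 h1
    have hb : ∀ i x, |fderiv ℝ a x (stdOrthonormalBasis ℝ E i)| ≤ M := fun i x ↦ by
      have h := h1 [i] (by simp) (by simp) x
      simpa [FunctionSpaces.iterDirDeriv, Real.norm_eq_abs] using h
    rw [sobolevEnergy_succ, sobolevEnergy_succ]
    simp only [sobolevEnergy_zero_left]
    set c₁ := ENNReal.ofReal (1 + ε) with hc₁
    set c₂ := ENNReal.ofReal (1 + ε⁻¹) with hc₂
    have hmain : ∀ i, ∫⁻ x, ‖fderiv ℝ (fun y ↦ a y • g y) x (stdOrthonormalBasis ℝ E i)‖ₑ ^ 2 ≤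
        c₁ * (ENNReal.ofReal (M₀ ^ 2) * ∫⁻ x, ‖fderiv ℝ g x (stdOrthonormalBasis ℝ E i)‖ₑ ^ 2) +
          c₂ * (ENNReal.ofReal (M ^ 2) * ∫⁻ x, ‖g x‖ₑ ^ 2) := fun i ↦ by
      simp only [fderiv_smul_apply_eq ha hg]
      have hc : Continuous fun x ↦ a x • fderiv ℝ g x (stdOrthonormalBasis ℝ E i) :=
        ha.continuous.smul ((hg.continuous_fderiv (by simp)).clm_apply continuous_const)
      refine (lintegral_enorm_add_sq_le_eps hc hε).trans (add_le_add ?_ ?_)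
      · refine mul_le_mul' le_rfl ?_
        rw [← lintegral_const_mul' _ _ (by simp)]
        exact lintegral_mono fun x ↦ enorm_smul_sq_le (h0 x) _
      · refine mul_le_mul' le_rfl ?_
        rw [← lintegral_const_mul' _ _ (by simp)]
        exact lintegral_mono fun x ↦ enorm_smul_sq_le (hb i x) _
    have hzero : (∫⁻ x, ‖a x • g x‖ₑ ^ 2) ≤ ENNReal.ofReal (M₀ ^ 2) * ∫⁻ x, ‖g x‖ₑ ^ 2 := by
      have h := sobolevEnergy_smul_le_zero h0 g
      simpa only [sobolevEnergy_zero_left] using h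
    have hc₁1 : 1 ≤ c₁ := ENNReal.one_le_ofReal.2 (by linarith)
    set A := ENNReal.ofReal (M₀ ^ 2)
    set B := ENNReal.ofReal (M ^ 2)
    set n : ℝ≥0∞ := (Module.finrank ℝ E : ℝ≥0∞)
    set e0 := ∫⁻ x, ‖g x‖ₑ ^ 2
    set e1 := fun i ↦ ∫⁻ x, ‖fderiv ℝ g x (stdOrthonormalBasis ℝ E i)‖ₑ ^ 2
    calc (∫⁻ x, ‖a x • g x‖ₑ ^ 2) +
          ∑ i, ∫⁻ x, ‖fderiv ℝ (fun y ↦ a y • g y) x (stdOrthonormalBasis ℝ E i)‖ₑ ^ 2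
        ≤ A * e0 + ∑ i, (c₁ * (A * e1 i) + c₂ * (B * e0)) :=
          add_le_add hzero (Finset.sum_le_sum fun i _ ↦ hmain i)
      _ = A * e0 + c₁ * A * ∑ i, e1 i + n * c₂ * B * e0 := by
          rw [Finset.sum_add_distrib, Finset.sum_const, Finset.card_univ, Fintype.card_fin,
            ← Finset.mul_sum, ← Finset.mul_sum, nsmul_eq_mul]
          ring
      _ ≤ c₁ * A * e0 + c₁ * A * ∑ i, e1 i + n * c₂ * B * e0 := by
          refine add_le_add (add_le_add ?_ le_rfl) le_rfl
          refine mul_le_mul' ?_ le_rfl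
          calc A = 1 * A := (one_mul A).symm
            _ ≤ c₁ * A := mul_le_mul' hc₁1 le_rfl
      _ = c₁ * A * (e0 + ∑ i, e1 i) + n * c₂ * B * e0 := by ring
  | succ k ih =>
    intro ε hε hε1
    -- the induction hypothesis with `δ = ε/3`, and the crude bound at order `k + 1`
    set δ : ℝ := ε / 3 with hδ
    have hδ0 : 0 < δ := by positivity
    have hδ1 : δ ≤ 1 := by rw [hδ]; linarith
    obtain ⟨C, hCtop, hC⟩ := ih hδ0 hδ1
    obtain ⟨C', hC'top, hC'⟩ := sobolevEnergy_smul_le_crude (E := E) (F := F) (k + 1)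
    set n : ℝ≥0∞ := (Module.finrank ℝ E : ℝ≥0∞) with hn
    refine ⟨ENNReal.ofReal (1 + δ) * C + n * ENNReal.ofReal (1 + δ⁻¹) * C', ?_, ?_⟩
    · exact ENNReal.add_ne_top.2 ⟨ENNReal.mul_ne_top (by simp) hCtop,
        ENNReal.mul_ne_top (ENNReal.mul_ne_top (by rw [hn]; exact ENNReal.natCast_ne_top _)
          (by simp)) hC'top⟩
    intro a g ha hg M₀ M h0 h1
    -- bounds for `∂ᵢ a`
    have hai : ∀ i, ContDiff ℝ ∞ fun x ↦ fderiv ℝ a x (stdOrthonormalBasis ℝ E i) := fun i ↦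
      (ha.fderiv_right (m := ∞) (by norm_cast)).clm_apply contDiff_const
    have h0i : ∀ i x, |fderiv ℝ a x (stdOrthonormalBasis ℝ E i)| ≤ M := fun i x ↦ by
      have h := h1 [i] (by simp) (by simp) x
      simpa [FunctionSpaces.iterDirDeriv, Real.norm_eq_abs] using h
    have h1i : ∀ i, ∀ l : List (Fin (Module.finrank ℝ E)), l ≠ [] → l.length ≤ k + 1 →
        ∀ x, ‖iterDirDeriv (l.map (stdOrthonormalBasis ℝ E))
          (fun y ↦ fderiv ℝ a y (stdOrthonormalBasis ℝ E i)) x‖ ≤ M := by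
      intro i l hl hlen x
      have h := h1 (l ++ [i]) (by simp) (by simp; omega) x
      rwa [List.map_append, List.map_singleton, iterDirDeriv_append_singleton] at h
    have h1' : ∀ l : List (Fin (Module.finrank ℝ E)), l ≠ [] → l.length ≤ k + 1 →
        ∀ x, ‖iterDirDeriv (l.map (stdOrthonormalBasis ℝ E)) a x‖ ≤ M :=
      fun l hl hlen x ↦ h1 l hl (by omega) x
    have hgi : ∀ i, ContDiff ℝ ∞ fun x ↦ fderiv ℝ g x (stdOrthonormalBasis ℝ E i) := fun i ↦
      (hg.fderiv_right (m := ∞) (by norm_cast)).clm_apply contDiff_const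
    -- the two estimates of the pieces of `∂ᵢ(ag) = a ∂ᵢg + (∂ᵢa) g`
    have hIH1 : ∀ i, sobolevEnergy (k + 1) (fun x ↦ a x • fderiv ℝ g x (stdOrthonormalBasis ℝ E i)) ≤
        ENNReal.ofReal (1 + δ) * ENNReal.ofReal (M₀ ^ 2) * sobolevEnergy (k + 1)
          (fun x ↦ fderiv ℝ g x (stdOrthonormalBasis ℝ E i)) +
          C * ENNReal.ofReal (M ^ 2) * sobolevEnergy k (fun x ↦ fderiv ℝ g x (stdOrthonormalBasis ℝ E i)) :=
      fun i ↦ hC ha (hgi i) h0 h1'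
    have hIH2 : ∀ i, sobolevEnergy (k + 1) (fun x ↦ (fderiv ℝ a x (stdOrthonormalBasis ℝ E i)) • g x) ≤
        C' * ENNReal.ofReal (M ^ 2) * sobolevEnergy (k + 1) g := fun i ↦
      hC' (hai i) hg (h0i i) (h1i i)
    -- unfold one level and estimate
    rw [sobolevEnergy_succ (k + 1) (fun x ↦ a x • g x), sobolevEnergy_succ (k + 1) g]
    set d₁ := ENNReal.ofReal (1 + δ) with hd₁
    set d₂ := ENNReal.ofReal (1 + δ⁻¹) with hd₂
    have hmain : ∀ i, sobolevEnergy (k + 1)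
        (fun x ↦ fderiv ℝ (fun y ↦ a y • g y) x (stdOrthonormalBasis ℝ E i)) ≤
        d₁ * (d₁ * ENNReal.ofReal (M₀ ^ 2) * sobolevEnergy (k + 1)
            (fun x ↦ fderiv ℝ g x (stdOrthonormalBasis ℝ E i)) +
          C * ENNReal.ofReal (M ^ 2) * sobolevEnergy k (fun x ↦ fderiv ℝ g x (stdOrthonormalBasis ℝ E i))) +
        d₂ * (C' * ENNReal.ofReal (M ^ 2) * sobolevEnergy (k + 1) g) := fun i ↦ by
      have heq : (fun x ↦ fderiv ℝ (fun y ↦ a y • g y) x (stdOrthonormalBasis ℝ E i)) =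
          fun x ↦ a x • fderiv ℝ g x (stdOrthonormalBasis ℝ E i) +
            (fderiv ℝ a x (stdOrthonormalBasis ℝ E i)) • g x :=
        funext fun x ↦ fderiv_smul_apply_eq ha hg x _
      rw [heq]
      refine (sobolevEnergy_add_le_eps (k + 1) ((ha.smul (hgi i)).of_le (by exact_mod_cast le_top))
        (((hai i).smul hg).of_le (by exact_mod_cast le_top)) hδ0).trans ?_
      exact add_le_add (mul_le_mul' le_rfl (hIH1 i)) (mul_le_mul' le_rfl (hIH2 i))
    have hzero : (∫⁻ x, ‖a x • g x‖ₑ ^ 2) ≤ ENNReal.ofReal (M₀ ^ 2) * ∫⁻ x, ‖g x‖ₑ ^ 2 := by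
      have h := sobolevEnergy_smul_le_zero h0 g
      simpa only [sobolevEnergy_zero_left] using h
    -- `d₁² ≤ ofReal (1 + ε)` and `1 ≤ d₁`
    have hd₁1 : 1 ≤ d₁ := ENNReal.one_le_ofReal.2 (by linarith)
    have hd₁sq : d₁ * d₁ ≤ ENNReal.ofReal (1 + ε) := by
      rw [hd₁, ← ENNReal.ofReal_mul (by linarith), ← sq]
      exact ENNReal.ofReal_le_ofReal (one_add_third_sq_le hε.le hε1)
    -- bookkeeping
    set A := ENNReal.ofReal (M₀ ^ 2) with hA
    set B := ENNReal.ofReal (M ^ 2) with hB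
    set e0 := ∫⁻ x, ‖g x‖ₑ ^ 2
    set e1 := fun i ↦ sobolevEnergy (k + 1) (fun x ↦ fderiv ℝ g x (stdOrthonormalBasis ℝ E i))
    set e2 := fun i ↦ sobolevEnergy k (fun x ↦ fderiv ℝ g x (stdOrthonormalBasis ℝ E i))
    have hsum2 : ∑ i, e2 i ≤ sobolevEnergy (k + 1) g := sum_sobolevEnergy_fderiv_le k g
    calc (∫⁻ x, ‖a x • g x‖ₑ ^ 2) + ∑ i, sobolevEnergy (k + 1)
          (fun x ↦ fderiv ℝ (fun y ↦ a y • g y) x (stdOrthonormalBasis ℝ E i))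
        ≤ A * e0 + ∑ i, (d₁ * (d₁ * A * e1 i + C * B * e2 i) + d₂ * (C' * B * sobolevEnergy (k + 1) g)) :=
          add_le_add hzero (Finset.sum_le_sum fun i _ ↦ hmain i)
      _ = A * e0 + d₁ * d₁ * A * ∑ i, e1 i + d₁ * C * B * ∑ i, e2 i +
            n * d₂ * C' * B * sobolevEnergy (k + 1) g := by
          have hs : ∑ i, (d₁ * (d₁ * A * e1 i + C * B * e2 i) +
              d₂ * (C' * B * sobolevEnergy (k + 1) g)) =
              d₁ * (d₁ * A) * ∑ i, e1 i + d₁ * (C * B) * ∑ i, e2 i +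
                n * (d₂ * (C' * B * sobolevEnergy (k + 1) g)) := by
            rw [Finset.sum_add_distrib, Finset.sum_const, Finset.card_univ, Fintype.card_fin,
              nsmul_eq_mul]
            congr 1
            simp only [mul_add, Finset.sum_add_distrib, ← Finset.mul_sum, mul_assoc]
          rw [hs]
          ring
      _ ≤ d₁ * d₁ * A * e0 + d₁ * d₁ * A * ∑ i, e1 i + d₁ * C * B * sobolevEnergy (k + 1) g +
            n * d₂ * C' * B * sobolevEnergy (k + 1) g := by
          refine add_le_add (add_le_add (add_le_add ?_ le_rfl) (mul_le_mul' le_rfl hsum2)) le_rfl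
          refine mul_le_mul' ?_ le_rfl
          calc A = 1 * 1 * A := by rw [one_mul, one_mul]
            _ ≤ d₁ * d₁ * A := mul_le_mul' (mul_le_mul' hd₁1 hd₁1) le_rfl
      _ = d₁ * d₁ * A * (e0 + ∑ i, e1 i) +
            (d₁ * C + n * d₂ * C') * B * sobolevEnergy (k + 1) g := by ring
      _ ≤ ENNReal.ofReal (1 + ε) * A * (e0 + ∑ i, e1 i) +
            (d₁ * C + n * d₂ * C') * B * sobolevEnergy (k + 1) g := by
          gcongr

/-- **Principal-part form.** For a finite family of smooth scalar fields `m_p` with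
`|m_p| ≤ M₀` and iterated directional derivatives of orders `1, …, k + 1` bounded by `M`, and
smooth vector fields `g_p`:
`E_{k+1}(Σ_{p ∈ s} m_p • g_p) ≤ #s · Σ_{p ∈ s} [(1 + ε) M₀² E_{k+1}(g_p) + C M² E_k(g_p)]`
with the constant `C` of `sobolevEnergy_smul_le_sharp`. [cite: Evans2010, §5.2.3, Thm. 1] -/
theorem sobolevEnergy_sum_smul_le_sharp (k : ℕ) {ε : ℝ} (hε : 0 < ε) (hε1 : ε ≤ 1) :
    ∃ C : ℝ≥0∞, C ≠ ⊤ ∧ ∀ {ι : Type*} (s : Finset ι) {m : ι → E → ℝ} {g : ι → E → F},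
      (∀ p ∈ s, ContDiff ℝ ∞ (m p)) → (∀ p ∈ s, ContDiff ℝ ∞ (g p)) →
      ∀ {M₀ M : ℝ}, (∀ p ∈ s, ∀ x, |m p x| ≤ M₀) →
        (∀ p ∈ s, ∀ l : List (Fin (Module.finrank ℝ E)), l ≠ [] → l.length ≤ k + 1 →
          ∀ x, ‖iterDirDeriv (l.map (stdOrthonormalBasis ℝ E)) (m p) x‖ ≤ M) →
        sobolevEnergy (k + 1) (fun x ↦ ∑ p ∈ s, m p x • g p x) ≤
          (s.card : ℝ≥0∞) * ∑ p ∈ s,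
            (ENNReal.ofReal (1 + ε) * ENNReal.ofReal (M₀ ^ 2) * sobolevEnergy (k + 1) (g p) +
              C * ENNReal.ofReal (M ^ 2) * sobolevEnergy k (g p)) := by
  obtain ⟨C, hCtop, hC⟩ := sobolevEnergy_smul_le_sharp (E := E) (F := F) k hε hε1
  refine ⟨C, hCtop, ?_⟩
  intro ι s m g hm hg M₀ M h0 h1
  have hsm : ∀ p ∈ s, ContDiff ℝ (↑(k + 1) : WithTop ℕ∞) (fun x ↦ m p x • g p x) := fun p hp ↦
    ((hm p hp).smul (hg p hp)).of_le (by exact_mod_cast le_top)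
  refine (sobolevEnergy_sum_le_card (k + 1) s hsm).trans ?_
  refine mul_le_mul' le_rfl (Finset.sum_le_sum fun p hp ↦ ?_)
  exact hC (hm p hp) (hg p hp) (h0 p hp) (h1 p hp)

end Literature.Analysis.PDE

end
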